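import Literature.IUT.HodgeTheaters.PiAvatarBaseKitNFInstances
import Literature.IUT.HodgeTheaters.PMBaseEllBridgeSymmetryGroup
import Literature.IUT.HodgeTheaters.InitialThetaDataTorsionMonodromyUnramified
import Literature.IUT.HodgeTheaters.PuncturedEllipticCoveringsArrowClaimsOfModLCuspLaws
import HarnessLib

/-!
# [IUTchI] Prop 6.8 (i), the finite-GROUP / outer-isomorphism / stabiliser clause BY NAME at the genuine §6 base kits, and
# Prop 6.6 (ii)(iii), 6.8 (i) AS PRINTED (the guard `Nonempty 𝕍` DISCHARGED: `V̲^bad ≠ ∅`) at those kits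
# (proof-only; cone rows IUTchI:Prop6.8(i), IUTchI:Prop6.6(ii), IUTchI:Prop6.6(iii); R-C W9 (ii), abc-iut-L5-t13 gen 5)

S. Mochizuki, *Inter-universal Teichmüller theory I: construction of Hodge theaters*, kurims manuscript (May 2020), Prop 6.8 (i)
p. 167 l.38 – p. 168 l.8, Prop 6.6 (ii)(iii) p. 165, Def 3.1 (b) p. 61 («`V^bad_mod` … a nonempty set»), Ex 6.3 (ii) p. 161
[claim: Mochizuki2012, status: disputed] (D-0012 claim key; series status DISPUTED — kernel theorems about abc-iut-L5-t4's
CONSTRUCTIONS `InitialThetaData.baseKit*` over abc-iut-L5-t2's REAL `InitialThetaData`; nothing of the series is asserted, no side is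
taken on [IUTchIII] Cor. 3.12).

## Why this file
Prop 6.8 (i) says that the `𝒟-Θ^{ell}`-bridge underlying a `𝒟-Θ^{±ell}`-Hodge theater «admits an `𝔽_l^{⋊±}`-symmetry — i.e., more precisely,
a symmetry given by the action of a finite group that is equipped with a natural outer isomorphism to `𝔽_l^{⋊±}` — which acts doubly
transitively [i.e., transitively with stabilizers of order two] on the index set» (p. 168 l.2–7).  abc-iut-L5-t4's named statement
`PMBaseKit.DThetaPMEllHT.EllBridgeSymmetry` renders «transitive + `2·|T|` symmetries» under the guard `Nonempty 𝕍 →`, and that is the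
form restated at the genuine kits (`ellBridgeSymmetry_baseKit*`, p446174 / p446463 / p448457 / p447892 / `PiAvatarBaseKitNFInstances`)
and in the layer certificate (`Summit.ABC.IUTFork.Conditional.layer5_held_sec6_v10_genuineKit_unramified`, p449860).  The
finite-GROUP / outer-isomorphism / stabiliser clause itself was typed and proved CONDITIONALLY by abc-iut-w5-d228
(`PMBaseKit.DThetaPMEllHT.ellBridgeSymmetryGroup_of_equivariant (hE) (hV)`, `card_ellBridgeIso_of_equivariant`; sub-DAG
`plan/L5/SUBDAG-IUTchI-Prop67-Prop68i.md` rows P68i-L03/L04) but so far occurs in NO genuine-kit module.  This file supplies: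
* kit level — `ellBridgeSymmetryGroup_of_negCompatModel` / `card_ellBridgeIso_of_negCompatModel` (the binder `hE` ⟸ (β)
  `Ex63.NegCompatModel` via abc-iut-w4-d073's `NegCompatModel.equivariant`), and the UNGUARDED forms of the three typed torsor rows
  (`DThetaEllBridge.isoTorsor_unguarded_of_negCompatModel`, `DThetaPMEllHT.isoTorsor_unguarded_of_negCompatModel`,
  `DThetaPMEllHT.ellBridgeSymmetry_unguarded_of_negCompatModel`) given `Nonempty 𝕍`;
* the guard DISCHARGED at the genuine data — `InitialThetaData.nonempty_indexCopy` (Def 3.1 (b): `V^bad_mod ≠ ∅`, abc-iut-L5-t2's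
  `Vbad_nonempty`; the index type of every genuine kit is the `Type 0` copy `IndexCopy` of `V̲`), `nonempty_V_baseKit*`;
* at `baseKit` (p445979) · `baseKitOfTorsionMonodromy` (p446463; general `hsign`, so `baseKitArrowStandIn` p447892 is an instance) ·
  `baseKitOfBadPairs` / `baseKitStandIn` (p448457) · `baseKitNFStandIn` (`PiAvatarBaseKitNFInstances`) · the certificate's unramified kit
  (binders DATA `D CG M' B` · LAWS `hS hL ΛBad`, abc-iut-w5-d086's `prop65i_…_unramified` shape, p452410): **`ellBridgeSymmetryGroup_baseKit*`**
  (Prop 6.8 (i) group clause, UNGUARDED), **`card_ellBridgeIso_baseKit*`** (`= 2·l = |𝔽_l^{⋊±}|`), and (at `baseKit`, `baseKitOfTorsionMonodromy`,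
  `baseKitStandIn`, the certificate's kit) **`sec6_torsors_asPrinted_baseKit*`** = Prop 6.6 (ii) ∧ 6.6 (iii) ∧ 6.8 (i) WITHOUT the
  `Nonempty 𝕍 →` guard (print has no «if `V̲ ≠ ∅`»: `V̲^bad` is nonempty by Def 3.1 (b)).
Binders BY NAME exactly as the kit they decorate (`CG`, `hS`, `hsurj`/`M`, `hA`/`hL`, `hI`, `B`, `Λ`/`ΛBad`/`hsign`); NV / token flips untouched
(abc-iut-L5-lead NODE RULE #17, RULINGS #71: the flip waits for «JOINT-NV-CG» + census — this file is census material only).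
Proof-only: no `def`, no `instance`, no `notation`, no new `Prop` fact; typed ≠ inhabited ≠ proved; a binder is an assumption label.
HONEST FRAMING: nothing here asserts that abc is proved or refuted; establishment = OUR kernel check only.
-/

namespace Literature.IUT.HodgeTheaters

open CategoryTheory

universe u v w

/-! ## Kit level: the group clause and the unguarded torsor rows from (β) `NegCompatModel` -/

namespace PMBaseKit

variable {l : ℕ} {K : PMBaseKit.{u} l}

/-- **[IUTchI] Prop 6.8 (i), the GROUP clause, from (β)**: abc-iut-w5-d228's `ellBridgeSymmetryGroup_of_equivariant` with its binder `hE`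
supplied by `Ex63.NegCompatModel K` (abc-iut-w4-d073 `NegCompatModel.equivariant`): (a) `g ↦` (index bijection) is a bijection from the
symmetries of `†φ^{Θell}_±` onto the finite group `Aut_±(T)`; (b) every chart reads `Aut_±(T)` isomorphically onto `𝔽_l^{⋊±}` (a natural
OUTER isomorphism); (c) transitive with stabilisers of order two. ([IUTchI] Prop 6.8 (i) p.168) [claim: Mochizuki2012, status: disputed] -/
theorem DThetaPMEllHT.ellBridgeSymmetryGroup_of_negCompatModel (h : Ex63.NegCompatModel K) (H : K.DThetaPMEllHT)
    (hV : Nonempty K.V) :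
    Function.Bijective (fun g : DThetaEllBridge.Iso H.ellBridge H.ellBridge =>
        (⟨(g.indexEquiv : Equiv.Perm H.T), H.ellBridgeIso_indexEquiv_mem_autPM g⟩ : H.grpT.toTorsor.autPM)) ∧
      (∀ e ∈ H.grpT.toTorsor.charts, ∃ φ : H.grpT.toTorsor.autPM ≃* FlPM l,
        ∀ (σ : H.grpT.toTorsor.autPM) (t : H.T), e (σ.1 t) = φ σ • e t) ∧
      MulAction.IsPretransitive H.grpT.toTorsor.autPM H.T ∧
      ∀ t : H.T, Nat.card (MulAction.stabilizer H.grpT.toTorsor.autPM t) = 2 :=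
  DThetaPMEllHT.ellBridgeSymmetryGroup_of_equivariant (fun _ hγ => h.equivariant hγ) H hV

/-- **Prop 6.8 (i), the count read off the group, from (β)**: `#Iso(†φ^{Θell}_±, †φ^{Θell}_±) = 2·l = |𝔽_l^{⋊±}|`.
([IUTchI] Prop 6.8 (i) p.168) [claim: Mochizuki2012, status: disputed] -/
theorem DThetaPMEllHT.card_ellBridgeIso_of_negCompatModel (h : Ex63.NegCompatModel K) (H : K.DThetaPMEllHT)
    (hV : Nonempty K.V) : Nat.card (DThetaEllBridge.Iso H.ellBridge H.ellBridge) = 2 * l :=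
  DThetaPMEllHT.card_ellBridgeIso_of_equivariant (fun _ hγ => h.equivariant hγ) H hV

/-- **[IUTchI] Prop 6.6 (ii) AS PRINTED (no `Nonempty 𝕍` guard), from (β)**: the isomorphisms between two `𝒟-Θ^{ell}`-bridges form a
nonempty set mapping bijectively onto the `𝔽_l^±`-torsor isomorphisms of the index sets (abc-iut-L5-t13/w4-d073
`DThetaEllBridge.isoTorsor_of_negCompatModel` with the guard fed). ([IUTchI] Prop 6.6 (ii) p.165) [claim: Mochizuki2012, status: disputed] -/
theorem DThetaEllBridge.isoTorsor_unguarded_of_negCompatModel (h : Ex63.NegCompatModel K) (hV : Nonempty K.V)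
    (B₁ B₂ : K.DThetaEllBridge) :
    Nonempty (DThetaEllBridge.Iso B₁ B₂) ∧
      Function.Bijective fun g : DThetaEllBridge.Iso B₁ B₂ =>
        (⟨g.indexEquiv, g.indexEquiv_charts⟩ : {ι : B₁.T ≃ B₂.T // B₁.torT.Compat B₂.torT ι}) :=
  DThetaEllBridge.isoTorsor_of_negCompatModel h B₁ B₂ hV

/-- **[IUTchI] Prop 6.6 (iii) AS PRINTED (no `Nonempty 𝕍` guard), from (β)**: the isomorphisms between two `𝒟-Θ^{±ell}`-Hodge theaters
form a nonempty set mapping bijectively onto the `𝔽_l^±`-group isomorphisms of the index sets.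
([IUTchI] Prop 6.6 (iii) p.165) [claim: Mochizuki2012, status: disputed] -/
theorem DThetaPMEllHT.isoTorsor_unguarded_of_negCompatModel (h : Ex63.NegCompatModel K) (hV : Nonempty K.V)
    (H₁ H₂ : K.DThetaPMEllHT) :
    Nonempty (DThetaPMEllHT.Iso H₁ H₂) ∧
      Function.Bijective fun g : DThetaPMEllHT.Iso H₁ H₂ =>
        (⟨g.pmIso.indexEquiv, g.pmIso.indexEquiv_charts⟩ : {ι : H₁.T ≃ H₂.T // H₁.grpT.Compat H₂.grpT ι}) :=
  DThetaPMEllHT.isoTorsor_of_negCompatModel h H₁ H₂ hV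

/-- **[IUTchI] Prop 6.8 (i) (transitivity + count `2·|T|`) AS PRINTED (no `Nonempty 𝕍` guard), from (β)**.
([IUTchI] Prop 6.8 (i) p.168) [claim: Mochizuki2012, status: disputed] -/
theorem DThetaPMEllHT.ellBridgeSymmetry_unguarded_of_negCompatModel (h : Ex63.NegCompatModel K) (hV : Nonempty K.V)
    (H : K.DThetaPMEllHT) :
    (∀ t₁ t₂ : H.T, ∃ g : DThetaEllBridge.Iso H.ellBridge H.ellBridge, g.indexEquiv t₁ = t₂) ∧
      Nat.card (DThetaEllBridge.Iso H.ellBridge H.ellBridge) = 2 * Nat.card H.T :=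
  DThetaPMEllHT.ellBridgeSymmetry_of_negCompatModel h H hV

end PMBaseKit

/-! ## The genuine kits of the initial Θ-data -/

section Prop68iGroupAtGenuineKits

variable {F : Type u} {K : Type v} {Fbar : Type w} [Field F] [NumberField F] [Field K] [NumberField K]
  [Algebra F K] [Field Fbar] [Algebra F Fbar] [Algebra K Fbar]
  {E : WeierstrassCurve F} [E.IsElliptic] {l : ℕ} {Pb : BadPlacePredicates K}
  (D : InitialThetaData F K Fbar E l Pb)

namespace InitialThetaData

/-! ### The guard `Nonempty 𝕍` DISCHARGED: `V̲ ⊇ V̲^bad ≠ ∅` -/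

/-- **`V̲ ≠ ∅`** — the `Type 0` copy `IndexCopy` of `V̲` (the index type of every genuine §6 base kit) is nonempty, since `V̲^bad ⊆ V̲` is nonempty
(Def 3.1 (b) «`V^bad_mod` … a nonempty set», abc-iut-L5-t2's `Vbad_nonempty`). ([IUTchI] Def 3.1 (b) p.61) [claim: Mochizuki2012, status: disputed] -/
theorem nonempty_indexCopy : Nonempty D.IndexCopy := by
  obtain ⟨w, hw⟩ := D.Vbad_nonempty
  exact ⟨D.indexCopyEquiv.symm ⟨w, hw.1⟩⟩

variable (CG : D.geom.pe.CuspGalois) (hS : D.CuspClassesNormaliserStable) [Fact l.Prime]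

/-! ### The genuine kit over `V̲`: `baseKit` (p445979) -/

section OverPlaces

variable (B : ∀ v, v ∈ D.indexCopyBad → D.BadPairAt v) [(D.PiXund.subgroupOf D.PiXK).Normal]
  (hsurj : Function.Surjective D.toFlStarGlobal) (hA : D.geom.pe.ArrowCoveringClaims)
  (Λ : ∀ v, D.LocalArrowLaw CG hS (D.localGroupAt B v))

/-- The index set of the genuine kit `baseKit` is nonempty (it is `V̲`). ([IUTchI] Def 3.1 (b) p.61) [claim: Mochizuki2012, status: disputed] -/
theorem nonempty_V_baseKit : Nonempty (D.baseKit B CG hS hsurj hA Λ).V :=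
  D.nonempty_indexCopy

/-- **[IUTchI] Prop 6.8 (i), the GROUP clause, at the genuine kit `baseKit`** (p445979): for every `𝒟-Θ^{±ell}`-Hodge theater `H` of the base
kit of the initial Θ-data, the symmetries of its `𝒟-Θ^{ell}`-bridge ARE the action of the finite group `Aut_±(T)` (bijection via index
bijections), `Aut_±(T)` carries a natural outer isomorphism to `𝔽_l^{⋊±}`, and acts transitively on `T` with stabilisers of order two — UNGUARDED.
([IUTchI] Prop 6.8 (i) p.168) [claim: Mochizuki2012, status: disputed] -/
theorem ellBridgeSymmetryGroup_baseKit (H : (D.baseKit B CG hS hsurj hA Λ).DThetaPMEllHT) :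
    Function.Bijective (fun g : PMBaseKit.DThetaEllBridge.Iso H.ellBridge H.ellBridge =>
        (⟨(g.indexEquiv : Equiv.Perm H.T), H.ellBridgeIso_indexEquiv_mem_autPM g⟩ : H.grpT.toTorsor.autPM)) ∧
      (∀ e ∈ H.grpT.toTorsor.charts, ∃ φ : H.grpT.toTorsor.autPM ≃* FlPM l,
        ∀ (σ : H.grpT.toTorsor.autPM) (t : H.T), e (σ.1 t) = φ σ • e t) ∧
      MulAction.IsPretransitive H.grpT.toTorsor.autPM H.T ∧
      ∀ t : H.T, Nat.card (MulAction.stabilizer H.grpT.toTorsor.autPM t) = 2 :=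
  PMBaseKit.DThetaPMEllHT.ellBridgeSymmetryGroup_of_negCompatModel (D.negCompatModel_baseKit B CG hS hsurj hA Λ) H
    (D.nonempty_V_baseKit CG hS B hsurj hA Λ)

/-- **[IUTchI] Prop 6.8 (i), the count, at the genuine kit `baseKit`**: `#Iso(†φ^{Θell}_±, †φ^{Θell}_±) = 2·l`.
([IUTchI] Prop 6.8 (i) p.168) [claim: Mochizuki2012, status: disputed] -/
theorem card_ellBridgeIso_baseKit (H : (D.baseKit B CG hS hsurj hA Λ).DThetaPMEllHT) :
    Nat.card (PMBaseKit.DThetaEllBridge.Iso H.ellBridge H.ellBridge) = 2 * l :=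
  PMBaseKit.DThetaPMEllHT.card_ellBridgeIso_of_negCompatModel (D.negCompatModel_baseKit B CG hS hsurj hA Λ) H
    (D.nonempty_V_baseKit CG hS B hsurj hA Λ)

/-- **[IUTchI] Prop 6.6 (ii) ∧ 6.6 (iii) ∧ 6.8 (i) AS PRINTED at the genuine kit `baseKit`** — the three typed torsor rows WITHOUT the
`Nonempty 𝕍 →` guard of `PMBaseBridgeProps` / `PMBaseProcessions` (the guard is a theorem here: `nonempty_V_baseKit`).
([IUTchI] Prop 6.6 (ii) p.165) [claim: Mochizuki2012, status: disputed] -/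
theorem sec6_torsors_asPrinted_baseKit :
    (∀ B₁ B₂ : (D.baseKit B CG hS hsurj hA Λ).DThetaEllBridge,
      Nonempty (PMBaseKit.DThetaEllBridge.Iso B₁ B₂) ∧
        Function.Bijective fun g : PMBaseKit.DThetaEllBridge.Iso B₁ B₂ =>
          (⟨g.indexEquiv, g.indexEquiv_charts⟩ : {ι : B₁.T ≃ B₂.T // B₁.torT.Compat B₂.torT ι})) ∧  -- IUTchI:Prop6.6(ii)
    (∀ H₁ H₂ : (D.baseKit B CG hS hsurj hA Λ).DThetaPMEllHT,
      Nonempty (PMBaseKit.DThetaPMEllHT.Iso H₁ H₂) ∧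
        Function.Bijective fun g : PMBaseKit.DThetaPMEllHT.Iso H₁ H₂ =>
          (⟨g.pmIso.indexEquiv, g.pmIso.indexEquiv_charts⟩ : {ι : H₁.T ≃ H₂.T // H₁.grpT.Compat H₂.grpT ι})) ∧  -- IUTchI:Prop6.6(iii)
    (∀ H : (D.baseKit B CG hS hsurj hA Λ).DThetaPMEllHT,
      (∀ t₁ t₂ : H.T, ∃ g : PMBaseKit.DThetaEllBridge.Iso H.ellBridge H.ellBridge, g.indexEquiv t₁ = t₂) ∧
        Nat.card (PMBaseKit.DThetaEllBridge.Iso H.ellBridge H.ellBridge) = 2 * Nat.card H.T) :=  -- IUTchI:Prop6.8(i)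
  ⟨PMBaseKit.DThetaEllBridge.isoTorsor_unguarded_of_negCompatModel (D.negCompatModel_baseKit B CG hS hsurj hA Λ)
      (D.nonempty_V_baseKit CG hS B hsurj hA Λ),
    PMBaseKit.DThetaPMEllHT.isoTorsor_unguarded_of_negCompatModel (D.negCompatModel_baseKit B CG hS hsurj hA Λ)
      (D.nonempty_V_baseKit CG hS B hsurj hA Λ),
    PMBaseKit.DThetaPMEllHT.ellBridgeSymmetry_unguarded_of_negCompatModel (D.negCompatModel_baseKit B CG hS hsurj hA Λ)
      (D.nonempty_V_baseKit CG hS B hsurj hA Λ)⟩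

end OverPlaces

/-! ### The minimally-bound kits from a torsion-monodromy datum (p446463 / p448457 / NF stand-in) -/

section OfTorsionMonodromy

variable (M : D.TorsionMonodromy) (hA : D.geom.pe.ArrowCoveringClaims)
  (hI : ∀ k ∈ D.geom.pe.inertia D.geom.pe.ε1, M.tau (D.geom.embK k) = 0)

section WithSign

variable (B : ∀ v, v ∈ D.indexCopyBad → D.BadPairAt v)
  (hsign : ∀ v : D.IndexCopy, v ∉ D.indexCopyBad → ∀ n : D.PiC,
    n ∈ Subgroup.normalizer ((D.PiXarrow ⊓ (D.decompAt v).comap D.augGF : Subgroup D.PiC) : Set D.PiC) →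
      ∀ hn : n ∈ Subgroup.normalizer ((D.PiXund : Subgroup D.PiC) : Set D.PiC),
        ∃ ε : ℤˣ, ∀ x, D.gChart₀Model CG (D.actF CG hS ⟨n, hn⟩ x) = ε • D.gChart₀Model CG x)
  (ΛBad : ∀ v (h : v ∈ D.indexCopyBad), D.LocalArrowLaw CG hS (B v h).H)

/-- **[IUTchI] Prop 6.8 (i), the GROUP clause, at `baseKitOfTorsionMonodromy`** (abc-iut-L5-t4 p446463; binders `CG hS M hA hI B hsign ΛBad`).
([IUTchI] Prop 6.8 (i) p.168) [claim: Mochizuki2012, status: disputed] -/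
theorem ellBridgeSymmetryGroup_baseKitOfTorsionMonodromy
    (H : (D.baseKitOfTorsionMonodromy CG hS M hA hI B hsign ΛBad).DThetaPMEllHT) :
    Function.Bijective (fun g : PMBaseKit.DThetaEllBridge.Iso H.ellBridge H.ellBridge =>
        (⟨(g.indexEquiv : Equiv.Perm H.T), H.ellBridgeIso_indexEquiv_mem_autPM g⟩ : H.grpT.toTorsor.autPM)) ∧
      (∀ e ∈ H.grpT.toTorsor.charts, ∃ φ : H.grpT.toTorsor.autPM ≃* FlPM l,
        ∀ (σ : H.grpT.toTorsor.autPM) (t : H.T), e (σ.1 t) = φ σ • e t) ∧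
      MulAction.IsPretransitive H.grpT.toTorsor.autPM H.T ∧
      ∀ t : H.T, Nat.card (MulAction.stabilizer H.grpT.toTorsor.autPM t) = 2 :=
  PMBaseKit.DThetaPMEllHT.ellBridgeSymmetryGroup_of_negCompatModel
    (D.negCompatModel_baseKitOfTorsionMonodromy CG hS M hA hI B hsign ΛBad) H
    D.nonempty_indexCopy

/-- **[IUTchI] Prop 6.8 (i), the count, at `baseKitOfTorsionMonodromy`**: `#Iso = 2·l`. ([IUTchI] Prop 6.8 (i) p.168) [claim: Mochizuki2012, status: disputed] -/
theorem card_ellBridgeIso_baseKitOfTorsionMonodromy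
    (H : (D.baseKitOfTorsionMonodromy CG hS M hA hI B hsign ΛBad).DThetaPMEllHT) :
    Nat.card (PMBaseKit.DThetaEllBridge.Iso H.ellBridge H.ellBridge) = 2 * l :=
  PMBaseKit.DThetaPMEllHT.card_ellBridgeIso_of_negCompatModel
    (D.negCompatModel_baseKitOfTorsionMonodromy CG hS M hA hI B hsign ΛBad) H
    D.nonempty_indexCopy

/-- **[IUTchI] Prop 6.6 (ii) ∧ 6.6 (iii) ∧ 6.8 (i) AS PRINTED (unguarded) at `baseKitOfTorsionMonodromy`.**
([IUTchI] Prop 6.6 (iii) p.165) [claim: Mochizuki2012, status: disputed] -/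
theorem sec6_torsors_asPrinted_baseKitOfTorsionMonodromy :
    (∀ B₁ B₂ : (D.baseKitOfTorsionMonodromy CG hS M hA hI B hsign ΛBad).DThetaEllBridge,
      Nonempty (PMBaseKit.DThetaEllBridge.Iso B₁ B₂) ∧
        Function.Bijective fun g : PMBaseKit.DThetaEllBridge.Iso B₁ B₂ =>
          (⟨g.indexEquiv, g.indexEquiv_charts⟩ : {ι : B₁.T ≃ B₂.T // B₁.torT.Compat B₂.torT ι})) ∧  -- IUTchI:Prop6.6(ii)
    (∀ H₁ H₂ : (D.baseKitOfTorsionMonodromy CG hS M hA hI B hsign ΛBad).DThetaPMEllHT,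
      Nonempty (PMBaseKit.DThetaPMEllHT.Iso H₁ H₂) ∧
        Function.Bijective fun g : PMBaseKit.DThetaPMEllHT.Iso H₁ H₂ =>
          (⟨g.pmIso.indexEquiv, g.pmIso.indexEquiv_charts⟩ : {ι : H₁.T ≃ H₂.T // H₁.grpT.Compat H₂.grpT ι})) ∧  -- IUTchI:Prop6.6(iii)
    (∀ H : (D.baseKitOfTorsionMonodromy CG hS M hA hI B hsign ΛBad).DThetaPMEllHT,
      (∀ t₁ t₂ : H.T, ∃ g : PMBaseKit.DThetaEllBridge.Iso H.ellBridge H.ellBridge, g.indexEquiv t₁ = t₂) ∧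
        Nat.card (PMBaseKit.DThetaEllBridge.Iso H.ellBridge H.ellBridge) = 2 * Nat.card H.T) :=  -- IUTchI:Prop6.8(i)
  ⟨PMBaseKit.DThetaEllBridge.isoTorsor_unguarded_of_negCompatModel
      (D.negCompatModel_baseKitOfTorsionMonodromy CG hS M hA hI B hsign ΛBad)
      D.nonempty_indexCopy,
    PMBaseKit.DThetaPMEllHT.isoTorsor_unguarded_of_negCompatModel
      (D.negCompatModel_baseKitOfTorsionMonodromy CG hS M hA hI B hsign ΛBad)
      D.nonempty_indexCopy,
    PMBaseKit.DThetaPMEllHT.ellBridgeSymmetry_unguarded_of_negCompatModel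
      (D.negCompatModel_baseKitOfTorsionMonodromy CG hS M hA hI B hsign ΛBad)
      D.nonempty_indexCopy⟩

end WithSign

section BadPairs

variable (B : ∀ v, v ∈ D.indexCopyBad → D.BadPairAt v) (ΛBad : ∀ v (h : v ∈ D.indexCopyBad), D.LocalArrowLaw CG hS (B v h).H)

/-- **[IUTchI] Prop 6.8 (i), the GROUP clause, at `baseKitOfBadPairs`** (abc-iut-L5-t4 p448457: genuine shape, (L2) sign DERIVED; binders
`CG hS M hA hI B ΛBad`). ([IUTchI] Prop 6.8 (i) p.168) [claim: Mochizuki2012, status: disputed] -/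
theorem ellBridgeSymmetryGroup_baseKitOfBadPairs (H : (D.baseKitOfBadPairs CG hS M hA hI B ΛBad).DThetaPMEllHT) :
    Function.Bijective (fun g : PMBaseKit.DThetaEllBridge.Iso H.ellBridge H.ellBridge =>
        (⟨(g.indexEquiv : Equiv.Perm H.T), H.ellBridgeIso_indexEquiv_mem_autPM g⟩ : H.grpT.toTorsor.autPM)) ∧
      (∀ e ∈ H.grpT.toTorsor.charts, ∃ φ : H.grpT.toTorsor.autPM ≃* FlPM l,
        ∀ (σ : H.grpT.toTorsor.autPM) (t : H.T), e (σ.1 t) = φ σ • e t) ∧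
      MulAction.IsPretransitive H.grpT.toTorsor.autPM H.T ∧
      ∀ t : H.T, Nat.card (MulAction.stabilizer H.grpT.toTorsor.autPM t) = 2 :=
  D.ellBridgeSymmetryGroup_baseKitOfTorsionMonodromy CG hS M hA hI B _ ΛBad H

/-- **[IUTchI] Prop 6.8 (i), the count, at `baseKitOfBadPairs`**: `#Iso = 2·l`. ([IUTchI] Prop 6.8 (i) p.168) [claim: Mochizuki2012, status: disputed] -/
theorem card_ellBridgeIso_baseKitOfBadPairs (H : (D.baseKitOfBadPairs CG hS M hA hI B ΛBad).DThetaPMEllHT) :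
    Nat.card (PMBaseKit.DThetaEllBridge.Iso H.ellBridge H.ellBridge) = 2 * l :=
  D.card_ellBridgeIso_baseKitOfTorsionMonodromy CG hS M hA hI B _ ΛBad H

end BadPairs

/-- **[IUTchI] Prop 6.8 (i), the GROUP clause, at the stand-in kit `baseKitStandIn`** (abc-iut-L5-t4 p448457, binders `CG hS M hA hI`;
honesty tag of that file: bad-place `𝒟_v̲` is a profinite STAND-IN). ([IUTchI] Prop 6.8 (i) p.168) [claim: Mochizuki2012, status: disputed] -/
theorem ellBridgeSymmetryGroup_baseKitStandIn (H : (D.baseKitStandIn CG hS M hA hI).DThetaPMEllHT) :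
    Function.Bijective (fun g : PMBaseKit.DThetaEllBridge.Iso H.ellBridge H.ellBridge =>
        (⟨(g.indexEquiv : Equiv.Perm H.T), H.ellBridgeIso_indexEquiv_mem_autPM g⟩ : H.grpT.toTorsor.autPM)) ∧
      (∀ e ∈ H.grpT.toTorsor.charts, ∃ φ : H.grpT.toTorsor.autPM ≃* FlPM l,
        ∀ (σ : H.grpT.toTorsor.autPM) (t : H.T), e (σ.1 t) = φ σ • e t) ∧
      MulAction.IsPretransitive H.grpT.toTorsor.autPM H.T ∧
      ∀ t : H.T, Nat.card (MulAction.stabilizer H.grpT.toTorsor.autPM t) = 2 :=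
  PMBaseKit.DThetaPMEllHT.ellBridgeSymmetryGroup_of_negCompatModel (D.negCompatModel_baseKitStandIn CG hS M hA hI) H
    D.nonempty_indexCopy

/-- **[IUTchI] Prop 6.8 (i), the count, at the stand-in kit `baseKitStandIn`**: `#Iso = 2·l`. ([IUTchI] Prop 6.8 (i) p.168) [claim: Mochizuki2012, status: disputed] -/
theorem card_ellBridgeIso_baseKitStandIn (H : (D.baseKitStandIn CG hS M hA hI).DThetaPMEllHT) :
    Nat.card (PMBaseKit.DThetaEllBridge.Iso H.ellBridge H.ellBridge) = 2 * l :=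
  PMBaseKit.DThetaPMEllHT.card_ellBridgeIso_of_negCompatModel (D.negCompatModel_baseKitStandIn CG hS M hA hI) H
    D.nonempty_indexCopy

/-- **[IUTchI] Prop 6.6 (ii) ∧ 6.6 (iii) ∧ 6.8 (i) AS PRINTED (unguarded) at the stand-in kit `baseKitStandIn`.**
([IUTchI] Prop 6.6 (iii) p.165) [claim: Mochizuki2012, status: disputed] -/
theorem sec6_torsors_asPrinted_baseKitStandIn :
    (∀ B₁ B₂ : (D.baseKitStandIn CG hS M hA hI).DThetaEllBridge,
      Nonempty (PMBaseKit.DThetaEllBridge.Iso B₁ B₂) ∧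
        Function.Bijective fun g : PMBaseKit.DThetaEllBridge.Iso B₁ B₂ =>
          (⟨g.indexEquiv, g.indexEquiv_charts⟩ : {ι : B₁.T ≃ B₂.T // B₁.torT.Compat B₂.torT ι})) ∧
    (∀ H₁ H₂ : (D.baseKitStandIn CG hS M hA hI).DThetaPMEllHT,
      Nonempty (PMBaseKit.DThetaPMEllHT.Iso H₁ H₂) ∧
        Function.Bijective fun g : PMBaseKit.DThetaPMEllHT.Iso H₁ H₂ =>
          (⟨g.pmIso.indexEquiv, g.pmIso.indexEquiv_charts⟩ : {ι : H₁.T ≃ H₂.T // H₁.grpT.Compat H₂.grpT ι})) ∧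
    (∀ H : (D.baseKitStandIn CG hS M hA hI).DThetaPMEllHT,
      (∀ t₁ t₂ : H.T, ∃ g : PMBaseKit.DThetaEllBridge.Iso H.ellBridge H.ellBridge, g.indexEquiv t₁ = t₂) ∧
        Nat.card (PMBaseKit.DThetaEllBridge.Iso H.ellBridge H.ellBridge) = 2 * Nat.card H.T) :=
  ⟨PMBaseKit.DThetaEllBridge.isoTorsor_unguarded_of_negCompatModel (D.negCompatModel_baseKitStandIn CG hS M hA hI)
      D.nonempty_indexCopy,
    PMBaseKit.DThetaPMEllHT.isoTorsor_unguarded_of_negCompatModel (D.negCompatModel_baseKitStandIn CG hS M hA hI)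
      D.nonempty_indexCopy,
    PMBaseKit.DThetaPMEllHT.ellBridgeSymmetry_unguarded_of_negCompatModel (D.negCompatModel_baseKitStandIn CG hS M hA hI)
      D.nonempty_indexCopy⟩

/-- **[IUTchI] Prop 6.8 (i), the GROUP clause, at the NF-widened stand-in kit `baseKitNFStandIn`** (abc-iut-L5-t4 `PiAvatarBaseKitNFInstances`).
([IUTchI] Prop 6.8 (i) p.168) [claim: Mochizuki2012, status: disputed] -/
theorem ellBridgeSymmetryGroup_baseKitNFStandIn (H : (D.baseKitNFStandIn CG hS M hA hI).DThetaPMEllHT) :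
    Function.Bijective (fun g : PMBaseKit.DThetaEllBridge.Iso H.ellBridge H.ellBridge =>
        (⟨(g.indexEquiv : Equiv.Perm H.T), H.ellBridgeIso_indexEquiv_mem_autPM g⟩ : H.grpT.toTorsor.autPM)) ∧
      (∀ e ∈ H.grpT.toTorsor.charts, ∃ φ : H.grpT.toTorsor.autPM ≃* FlPM l,
        ∀ (σ : H.grpT.toTorsor.autPM) (t : H.T), e (σ.1 t) = φ σ • e t) ∧
      MulAction.IsPretransitive H.grpT.toTorsor.autPM H.T ∧
      ∀ t : H.T, Nat.card (MulAction.stabilizer H.grpT.toTorsor.autPM t) = 2 :=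
  PMBaseKit.DThetaPMEllHT.ellBridgeSymmetryGroup_of_negCompatModel (D.negCompatModel_baseKitNFStandIn CG hS M hA hI) H
    D.nonempty_indexCopy

/-- **[IUTchI] Prop 6.8 (i), the count, at the NF-widened stand-in kit `baseKitNFStandIn`**: `#Iso = 2·l`. ([IUTchI] Prop 6.8 (i) p.168) [claim: Mochizuki2012, status: disputed] -/
theorem card_ellBridgeIso_baseKitNFStandIn (H : (D.baseKitNFStandIn CG hS M hA hI).DThetaPMEllHT) :
    Nat.card (PMBaseKit.DThetaEllBridge.Iso H.ellBridge H.ellBridge) = 2 * l :=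
  PMBaseKit.DThetaPMEllHT.card_ellBridgeIso_of_negCompatModel (D.negCompatModel_baseKitNFStandIn CG hS M hA hI) H
    D.nonempty_indexCopy

end OfTorsionMonodromy

/-! ### The certificate's kit: `baseKitOfTorsionMonodromy` at the UNRAMIFIED datum, binders DATA `D CG M' B` · LAWS `hS hL ΛBad` -/

section Unramified

variable (M' : D.UnramifiedTorsionMonodromy) (B : ∀ v, v ∈ D.indexCopyBad → D.BadPairAt v) (hL : D.geom.pe.ModLCuspLaws)
  (ΛBad : ∀ v (h : v ∈ D.indexCopyBad), D.LocalArrowLaw CG hS (B v h).H)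

/-- **[IUTchI] Prop 6.8 (i), the GROUP clause, at the certificate's kit** — the kit expression of
`Summit.ABC.IUTFork.Conditional.layer5_held_sec6_v10_genuineKit_unramified` (abc-iut-L5-d1 g6, p449860): `baseKitOfTorsionMonodromy` at the
UNRAMIFIED datum `M'` (abc-iut-L5-t8, `hI := M'.tau_inertia_ε1`), `hA := arrowCoveringClaims_pe_of_modLCuspLaws CG hL` (abc-iut-L5-t1 p448117),
good-place signs `localArrowLaw_L2_sign_local` (abc-iut-L5-d5 p446471); binders DATA `D CG M' B` · LAWS `hS hL ΛBad`, exactly the certificate's.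
([IUTchI] Prop 6.8 (i) p.168) [claim: Mochizuki2012, status: disputed] -/
theorem ellBridgeSymmetryGroup_baseKitOfTorsionMonodromy_unramified
    (H : (D.baseKitOfTorsionMonodromy CG hS M'.toTorsionMonodromy (D.arrowCoveringClaims_pe_of_modLCuspLaws CG hL)
        M'.tau_inertia_ε1 B
        (fun v _ => D.localArrowLaw_L2_sign_local CG hS (D.arrowCoveringClaims_pe_of_modLCuspLaws CG hL) (D.decompAt v)) ΛBad).DThetaPMEllHT) :
    Function.Bijective (fun g : PMBaseKit.DThetaEllBridge.Iso H.ellBridge H.ellBridge =>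
        (⟨(g.indexEquiv : Equiv.Perm H.T), H.ellBridgeIso_indexEquiv_mem_autPM g⟩ : H.grpT.toTorsor.autPM)) ∧
      (∀ e ∈ H.grpT.toTorsor.charts, ∃ φ : H.grpT.toTorsor.autPM ≃* FlPM l,
        ∀ (σ : H.grpT.toTorsor.autPM) (t : H.T), e (σ.1 t) = φ σ • e t) ∧
      MulAction.IsPretransitive H.grpT.toTorsor.autPM H.T ∧
      ∀ t : H.T, Nat.card (MulAction.stabilizer H.grpT.toTorsor.autPM t) = 2 :=
  D.ellBridgeSymmetryGroup_baseKitOfTorsionMonodromy CG hS M'.toTorsionMonodromy (D.arrowCoveringClaims_pe_of_modLCuspLaws CG hL)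
    M'.tau_inertia_ε1 B _ ΛBad H

/-- **[IUTchI] Prop 6.8 (i), the count, at the certificate's kit**: `#Iso = 2·l`. ([IUTchI] Prop 6.8 (i) p.168) [claim: Mochizuki2012, status: disputed] -/
theorem card_ellBridgeIso_baseKitOfTorsionMonodromy_unramified
    (H : (D.baseKitOfTorsionMonodromy CG hS M'.toTorsionMonodromy (D.arrowCoveringClaims_pe_of_modLCuspLaws CG hL)
        M'.tau_inertia_ε1 B
        (fun v _ => D.localArrowLaw_L2_sign_local CG hS (D.arrowCoveringClaims_pe_of_modLCuspLaws CG hL) (D.decompAt v)) ΛBad).DThetaPMEllHT) :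
    Nat.card (PMBaseKit.DThetaEllBridge.Iso H.ellBridge H.ellBridge) = 2 * l :=
  D.card_ellBridgeIso_baseKitOfTorsionMonodromy CG hS M'.toTorsionMonodromy (D.arrowCoveringClaims_pe_of_modLCuspLaws CG hL)
    M'.tau_inertia_ε1 B _ ΛBad H

/-- **[IUTchI] Prop 6.6 (ii) ∧ 6.6 (iii) ∧ 6.8 (i) AS PRINTED (unguarded) at the certificate's kit** — the three torsor conjuncts of
`layer5_held_sec6_v10_genuineKit_unramified` with their `Nonempty 𝕍 →` guards DISCHARGED (binders DATA `D CG M' B` · LAWS `hS hL ΛBad`).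
([IUTchI] Prop 6.6 (ii) p.165) [claim: Mochizuki2012, status: disputed] -/
theorem sec6_torsors_asPrinted_baseKitOfTorsionMonodromy_unramified :
    (∀ B₁ B₂ : (D.baseKitOfTorsionMonodromy CG hS M'.toTorsionMonodromy (D.arrowCoveringClaims_pe_of_modLCuspLaws CG hL)
        M'.tau_inertia_ε1 B
        (fun v _ => D.localArrowLaw_L2_sign_local CG hS (D.arrowCoveringClaims_pe_of_modLCuspLaws CG hL) (D.decompAt v)) ΛBad).DThetaEllBridge,
      Nonempty (PMBaseKit.DThetaEllBridge.Iso B₁ B₂) ∧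
        Function.Bijective fun g : PMBaseKit.DThetaEllBridge.Iso B₁ B₂ =>
          (⟨g.indexEquiv, g.indexEquiv_charts⟩ : {ι : B₁.T ≃ B₂.T // B₁.torT.Compat B₂.torT ι})) ∧  -- IUTchI:Prop6.6(ii)
    (∀ H₁ H₂ : (D.baseKitOfTorsionMonodromy CG hS M'.toTorsionMonodromy (D.arrowCoveringClaims_pe_of_modLCuspLaws CG hL)
        M'.tau_inertia_ε1 B
        (fun v _ => D.localArrowLaw_L2_sign_local CG hS (D.arrowCoveringClaims_pe_of_modLCuspLaws CG hL) (D.decompAt v)) ΛBad).DThetaPMEllHT,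
      Nonempty (PMBaseKit.DThetaPMEllHT.Iso H₁ H₂) ∧
        Function.Bijective fun g : PMBaseKit.DThetaPMEllHT.Iso H₁ H₂ =>
          (⟨g.pmIso.indexEquiv, g.pmIso.indexEquiv_charts⟩ : {ι : H₁.T ≃ H₂.T // H₁.grpT.Compat H₂.grpT ι})) ∧  -- IUTchI:Prop6.6(iii)
    (∀ H : (D.baseKitOfTorsionMonodromy CG hS M'.toTorsionMonodromy (D.arrowCoveringClaims_pe_of_modLCuspLaws CG hL)
        M'.tau_inertia_ε1 B
        (fun v _ => D.localArrowLaw_L2_sign_local CG hS (D.arrowCoveringClaims_pe_of_modLCuspLaws CG hL) (D.decompAt v)) ΛBad).DThetaPMEllHT,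
      (∀ t₁ t₂ : H.T, ∃ g : PMBaseKit.DThetaEllBridge.Iso H.ellBridge H.ellBridge, g.indexEquiv t₁ = t₂) ∧
        Nat.card (PMBaseKit.DThetaEllBridge.Iso H.ellBridge H.ellBridge) = 2 * Nat.card H.T) :=  -- IUTchI:Prop6.8(i)
  D.sec6_torsors_asPrinted_baseKitOfTorsionMonodromy CG hS M'.toTorsionMonodromy (D.arrowCoveringClaims_pe_of_modLCuspLaws CG hL)
    M'.tau_inertia_ε1 B _ ΛBad

end Unramified

end InitialThetaData

end Prop68iGroupAtGenuineKits

end Literature.IUT.HodgeTheaters
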